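import Summits.AtomisticToContinuum.BoseEinsteinCondensation.Theses.BECDressedKac

/-!
# Route `BECDressedKac`, support item `KacWindowOfDressed` (stmt-AtomisticToContinuum-14634)

`KacWindowOfDressed := DressedKacCondensation → KacWindowCondensation`: the pure positive-type
Kac-window condensation statement is the `v := w`, `f ≡ 1` instance of the dressed one.  Given the
dressed thresholds `(M, η, ε₀)` we take the Kac thresholds `(M, η)` and check that the dressed
hypotheses are met by the trivial profile `f ≡ 1` with `v := w`:

* value identity: `2·𝓔_w[1] = ∫ w(|x|) dx = ∫ w(|x|)·1²` (the gradient of a constant vanishes,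
  `scatteringFunctional w 1 = ∫ ½ w`);
* global minimality: `2·𝓔_w[1] + ∫ w φ² ≤ 2·𝓔_w[φ] + ∫ w·1²` reduces to `∫ w φ² ≤ 2·𝓔_w[φ]`, i.e.
  dropping the kinetic term;
* the Mayer defect `ρ ∫ (1 - 1²) = 0 ≤ ε₀`; the punctured-Lipschitz clause holds with constant `0`.

The conclusion of `DressedKacCondensation` at `v := w` is then literally the conclusion of
`KacWindowCondensation`.  (Interface check; it also makes `KacWindowCondensation`
refutation-load-bearing: `¬ Kac ⇒ ¬ Dressed`.)

References: Lieb–Seiringer–Solovej–Yngvason 2005, App. C (the scattering functional (C.4));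
Lieb 1966 (the quantum Kac limit motivating the window).
-/

open MeasureTheory
open scoped ENNReal NNReal

namespace Summit.AtomisticToContinuum.BoseEinsteinCondensation.Theorems

open Literature.MathematicalPhysics.QuantumManyBody.BoseGas

/-- `‖r‖₊² = r²` as extended non-negative reals. [folklore] -/
private theorem kacWindowOfDressed_coe_nnnorm_sq (r : ℝ) :
    (‖r‖₊ : ℝ≥0∞) ^ 2 = ENNReal.ofReal (r ^ 2) := by
  rw [← enorm_eq_nnnorm, ← enorm_pow, Real.enorm_eq_ofReal (sq_nonneg r)]

/-- The scattering functional of the constant trial function `1` is half the mass of the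
potential: `𝓔_w[1] = ∫ ½ w(|x|) dx`. [cite: LSSY2005, App. C (C.10)] -/
private theorem kacWindowOfDressed_scatteringFunctional_one (w : ℝ → ℝ≥0∞) :
    scatteringFunctional w (fun _ : Space => (1 : ℝ)) = ∫⁻ x : Space, 2⁻¹ * w ‖x‖ := by
  refine lintegral_congr fun x => ?_
  simp [gradSq]

/-- Value identity for `f ≡ 1`: `2·𝓔_w[1] = ∫ w(|x|) dx`. [cite: LSSY2005, App. C (C.10)] -/
private theorem kacWindowOfDressed_two_mul_scatteringFunctional_one (w : ℝ → ℝ≥0∞) :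
    2 * scatteringFunctional w (fun _ : Space => (1 : ℝ)) = ∫⁻ x : Space, w ‖x‖ := by
  rw [kacWindowOfDressed_scatteringFunctional_one,
    ← lintegral_const_mul' _ _ ENNReal.ofNat_ne_top]
  refine lintegral_congr fun x => ?_
  rw [← mul_assoc, ENNReal.mul_inv_cancel two_ne_zero ENNReal.ofNat_ne_top, one_mul]

/-- Dropping the kinetic term: `∫ w φ² ≤ 2·𝓔_w[φ]`. [cite: LSSY2005, App. C (C.4)] -/
private theorem kacWindowOfDressed_lintegral_mul_sq_le (w : ℝ → ℝ≥0∞) (φ : Space → ℝ) :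
    ∫⁻ x : Space, w ‖x‖ * ENNReal.ofReal (φ x ^ 2) ≤ 2 * scatteringFunctional w φ := by
  unfold scatteringFunctional
  rw [← lintegral_const_mul' _ _ ENNReal.ofNat_ne_top]
  refine lintegral_mono fun x => ?_
  rw [mul_add, ← kacWindowOfDressed_coe_nnnorm_sq, ← mul_assoc, ← mul_assoc,
    ENNReal.mul_inv_cancel two_ne_zero ENNReal.ofNat_ne_top, one_mul]
  exact le_add_self

/-- **`KacWindowOfDressed` holds** (settles stmt-AtomisticToContinuum-14634, exact route decl):
`DressedKacCondensation → KacWindowCondensation`, by instantiating the dressed statement at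
`v := w`, `f ≡ 1` with the same thresholds `(M, η)`: the value identity `2·𝓔_w[1] = ∫ w`, the
global minimality `∫ w φ² ≤ 2·𝓔_w[φ]`, the vanishing Mayer defect `ρ ∫ (1 - 1²) = 0 ≤ ε₀` and the
trivial Lipschitz clause are the only things to check. [folklore] -/
theorem kacWindowOfDressed_proof :
    Summit.AtomisticToContinuum.BoseEinsteinCondensation.Theses.BECDressedKac.KacWindowOfDressed := by
  unfold Summit.AtomisticToContinuum.BoseEinsteinCondensation.Theses.BECDressedKac.KacWindowOfDressed
    Summit.AtomisticToContinuum.BoseEinsteinCondensation.Theses.BECDressedKac.DressedKacCondensation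
    Summit.AtomisticToContinuum.BoseEinsteinCondensation.Theses.BECDressedKac.KacWindowCondensation
  rintro ⟨M, η, ε₀, hM, hη, _hε₀, hD⟩
  refine ⟨M, η, hM, hη, ?_⟩
  intro w R ρ hw hR hρ hBorn hRange hPos hKac hSub
  have h1 := kacWindowOfDressed_two_mul_scatteringFunctional_one w
  refine hD w w (fun _ => 1) R ρ hw hw hR hρ hRange hRange hBorn hPos
    (fun _ => ⟨zero_le_one, le_rfl⟩) (fun _ _ => rfl)
    (fun _ _ => ⟨0, (LipschitzWith.const (1 : ℝ)).lipschitzOnWith⟩) ?_ ?_ hKac hSub ?_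
  · -- value identity `2·𝓔_w[1] = ∫ w · 1²`
    rw [h1]
    refine lintegral_congr fun x => ?_
    simp
  · -- global minimality `2·𝓔_w[1] + ∫ w φ² ≤ 2·𝓔_w[φ] + ∫ w · 1²`
    intro φ _hφ
    have h2 : ∫⁻ x : Space, w ‖x‖ * ENNReal.ofReal ((1 : ℝ) ^ 2) = ∫⁻ x : Space, w ‖x‖ := by
      refine lintegral_congr fun x => ?_
      simp
    rw [h1, h2, add_comm]
    exact add_le_add (kacWindowOfDressed_lintegral_mul_sq_le w φ) le_rfl
  · -- Mayer defect `ρ ∫ (1 - 1²) = 0 ≤ ε₀`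
    simp

end Summit.AtomisticToContinuum.BoseEinsteinCondensation.Theorems
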